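import Literature.MathematicalPhysics.KineticTheory.RegularStationaryState
import HarnessLib

/-!
# The dilute hard-sphere gas: translation-invariant Gibbs states at low activity and their density

Topic `Literature/MathematicalPhysics/StatisticalMechanics`; namespace
`Literature.MathematicalPhysics.StatisticalMechanics` (next to `HardSphereGibbsState.lean`, whose header lists
"existence / uniqueness / translation invariance of `g_{z,u,β}` at small activity (Ruelle 1969 §4.2, Thm 4.2.3)"
among the things deliberately absent, and `HardSphereKirkwoodSalsburg.lean`, which constructs Ruelle's
Kirkwood–Salsburg fixed point `ksCorr` — correlation FUNCTIONS at small density — but no measure from it).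
Requested by crux stmt-AtomisticToContinuum-14135 (`Summits/AtomisticToContinuum/HydrodynamicLimit`, line
`FirstLemma`, file `…Theorems/AntiMazurCoboundariesCorrectorPressureDecayKiferDiluteGibbs.lean`), where it yields
the dilute translation-invariant Gibbs REFERENCE state of prescribed small density `σ³` and activity `≤ 2σ³`
(`DiluteGibbsState`) by the intermediate value theorem; it also strengthens the route item
`Theses.RelEntropyErgodic.LowActivityGibbsState` (existence and translation invariance only) by the density clause.

NAMED FACT (not proved here): `RuelleDiluteHardSphereGas` — for the gas of hard spheres of unit diameter in `ℝ³`
there are `z₁ > 0`, `C ≥ 0` and a density function `ρ`, continuous on `(0, z₁)` with `z - C z² ≤ ρ(z) ≤ z`, such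
that for all activities `0 < z < z₁`, inverse temperatures `β > 0` and drifts `u ∈ ℝ³` there is a
translation-invariant DLR state (`Literature.Analysis.FluidPDE.IsHardSphereGibbs 1 z β u`, Maxwellian velocity
marks `M_β(v - u)`; `Literature.Analysis.FluidPDE.IsTranslationInvariant`) of density `ρ(z)`
(`KineticTheory.PointProcess.density`, the mean number of centres with position in the unit cube). Sources:
Ruelle 1969 (Thm 4.2.3; §4.3 (a), Thm 4.3.1 and eq. (3.12): the infinite-volume correlation functions and the
density `ρ₁(z) = Σ n bₙ zⁿ` at small activity by the Kirkwood–Salsburg equations, with the first-order bound)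
and Dobrushin–Sinai–Sukhov 1989 (Chap. 10 §2.4 Thms 2.1–2.2 and §2.5 Def. 2.2: the infinite-volume state solves
the DLR equations, is translation invariant and unique at small activity, with independent Gaussian momenta).

What is deliberately NOT here: general stable regular (or superstable) pair potentials, other dimensions and
diameters (scalings of the unit-diameter gas), complex activity, analyticity of `ρ` and of all correlation
functions in `z`, uniqueness of the Gibbs state and its cluster / mixing properties, the pressure and the virial
expansion (Ruelle 1969 Thms 4.3.1–4.3.2).

## References

* D. Ruelle, *Statistical Mechanics: Rigorous Results*, Benjamin 1969, §4.2 (Thm 4.2.3, eqs. (2.5), (2.26),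
  (2.33), (2.35)), §4.3 ((a), Thm 4.3.1, eqs. (3.9), (3.12)). [Ruelle1969]
* R. L. Dobrushin, Ya. G. Sinai, Yu. M. Sukhov, *Dynamical systems of statistical mechanics* (Dynamical
  Systems II, Chap. 10), §2.4 Thms 2.1–2.2, §2.5 Def. 2.2. [DobrushinSinaiSukhov1989]
-/

noncomputable section

namespace Literature.MathematicalPhysics.StatisticalMechanics

/-- **The dilute hard-sphere gas: low-activity translation-invariant Gibbs states and their density
`ρ(z) = z + O(z²)`** (NAMED FACT). There are `z₁ > 0`, `C ≥ 0` and a function `ρ : ℝ → ℝ`, continuous on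
`(0, z₁)` with `z - C z² ≤ ρ(z) ≤ z` there, such that for every inverse temperature `β > 0`, drift `u ∈ ℝ³` and
activity `0 < z < z₁` the gas of hard spheres of unit diameter in `ℝ³` has a translation-invariant Gibbs state
`G` (a probability law on locally finite phase-space configurations solving the DLR equations with Maxwellian
velocity marks `M_β(v - u)`: the tree's `IsHardSphereGibbs 1 z β u G`, `IsTranslationInvariant G`) whose density
(mean number of centres with position in the unit cube, `PointProcess.density`) is `ρ(z)`.
Ruelle, *Statistical Mechanics: Rigorous Results* (1969), Thm 4.2.3: for a stable regular pair potential and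
`|z| < e^{-2βB-1} C(β)⁻¹` the infinite-volume correlation functions exist, are the unique solution of the
Kirkwood–Salsburg equation (2.26) in `E_ξ`, `ξ = C(β)⁻¹`, and depend analytically on `z` — for the pure hard
core `B = 0` and `C(β) = ∫ |e^{-βΦ} - 1| = 4π/3` (the exclusion ball), independent of `β`; §4.3 (a) and
Thm 4.3.1: by translation invariance of (2.26) the first correlation function is a constant `ρ₁(z) = Σ n bₙ zⁿ`,
the density, analytic in the same disc; eq. (3.12): `|ρ₁ - z| ≤ |z|² / (e^{-2βB-1}C(β)⁻¹ - |z|)`, whence,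
with `z₁ :=` half that radius and `C := z₁⁻¹`, `ρ₁ ≥ z - C z²` for `0 < z < z₁`; and `ρ₁ ≤ z` for a
non-negative potential (from (2.5), `ρ_Λ(x₁) ≤ z`, and (2.35)). That the infinite-volume state is a
translation-invariant solution of the DLR equations (unique at small activity, so that its first correlation
function is `ρ₁`) carrying independent Gaussian momenta of mean `u` and covariance `β⁻¹`:
Dobrushin–Sinai–Sukhov, *Dynamical systems of statistical mechanics* (Dynamical Systems II, Chap. 10), §2.4
Thms 2.1–2.2 (after Dobrushin 1969, Minlos 1967, Ruelle 1970) and §2.5 Def. 2.2.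
-- TODO(general form): Ruelle's theorem is for stable regular pair potentials in `ℝ^ν`, complex activity, ALL
-- correlation functions (analytic in `z`, uniqueness of the Kirkwood–Salsburg solution) and any hard-core
-- diameter; only the unit-diameter gas in `ℝ³`, continuity of the density and the two-sided first-order
-- bound `z - C z² ≤ ρ(z) ≤ z` are recorded here.
[cite: Ruelle1969, §4.2 Thm 4.2.3; §4.3 Thm 4.3.1 and eq. (3.12)]
[cite: DobrushinSinaiSukhov1989, Chap. 10 §2.4 Thm 2.1–2.2 and §2.5 Def. 2.2] -/
def RuelleDiluteHardSphereGas : Prop :=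
  ∃ z₁ C : ℝ, 0 < z₁ ∧ 0 ≤ C ∧
    ∃ ρ : ℝ → ℝ, ContinuousOn ρ (Set.Ioo 0 z₁) ∧
      (∀ z : ℝ, 0 < z → z < z₁ → z - C * z ^ 2 ≤ ρ z ∧ ρ z ≤ z) ∧
      ∀ β : ℝ, 0 < β → ∀ (u : Literature.MathematicalPhysics.KineticTheory.V3) (z : ℝ), 0 < z → z < z₁ →
        ∃ G : MeasureTheory.Measure (Literature.Analysis.FunctionSpaces.PointConfig
            (Literature.MathematicalPhysics.KineticTheory.V3 × Literature.MathematicalPhysics.KineticTheory.V3)),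
          Literature.Analysis.FluidPDE.IsHardSphereGibbs 1 z β u G ∧
            Literature.Analysis.FluidPDE.IsTranslationInvariant G ∧
            Literature.MathematicalPhysics.KineticTheory.PointProcess.density G = ENNReal.ofReal (ρ z)

end Literature.MathematicalPhysics.StatisticalMechanics

end
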